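import Literature.MathematicalPhysics.QuantumLattice.DWaveSourceParticleHole
import Literature.MathematicalPhysics.QuantumLattice.HubbardDysonDeterminant
import HarnessLib

/-!
# The Dyson series in `U` of the `d`-wave–sourced Hubbard partition function (determinant form)

Topic `MathematicalPhysics/QuantumLattice`. `DWaveSourceParticleHole.lean` conjugates the
INTERACTING `d`-wave–sourced Hubbard torus (and, on any finite graph, "BdG + on-site repulsion")
by Lieb's partial particle–hole transformation `W` into the number-conserving form
`dΓ(𝓗) + C·1 + U (N_↑ - Σ_x n_{x↑}n_{x↓})`. This file puts that form into the shape in which the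
tree's Dyson/Wick machinery for lattice fermions (`DysonOrderedIntegral`,
`FermionQuasiFreeTimeOrderedWick`, `HubbardDysonDeterminant`) is stated — a quadratic Hamiltonian
`dΓ(𝓚)` plus a coupling times the on-site quartic word — and reads off the perturbation series:

* `shibaOneBody τ Δ μ U = bdgNambuMatrix τ Δ μ + diag(U·[σ = ↑])` — the one-body matrix of the
  transformed model, the Hartree-like term `U N_↑` absorbed (`smul_sum_numberOp_up_eq_dGamma`);
  `isHermitian_shibaOneBody`.
* `partialParticleHole_conj_bdgBondHamiltonian_add_onSite_eq_dGamma` —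
  **`W (H_BdG(τ,Δ,μ) + U Σ_x n_{x↑}n_{x↓}) Wᴴ = dΓ(𝓚) + (-U) Σ_x c†_{x↑}c_{x↑}c†_{x↓}c_{x↓} + (Σ_x(τ(x,x)-μ))·1`**:
  a free lattice Fermi gas with one-body matrix `𝓚 = shibaOneBody τ Δ μ U` perturbed by the
  ATTRACTIVE on-site quartic word, coupling `-U`.
* `partitionFn_bdgBondHamiltonian_add_onSite_eq_shiba` —
  `Tr e^{-β(H_BdG + UΣn↑n↓)} = e^{-βΣ_x(τ(x,x)-μ)} Tr e^{-β(dΓ(𝓚) - UΣ_x c†_{x↑}c_{x↑}c†_{x↓}c_{x↓})}`;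
* **`hasSum_partitionFn_bdgBondHamiltonian_add_onSite_det`** — hence, by the Dyson expansion and
  the time-ordered Wick theorem in determinant form (BGM 2006 (2.6) at the operator level,
  `hasSum_dyson_partitionFn_quartic`, `gibbsState_dGamma_prod_hubbardVertex_eq_det`), for real
  `U` and Hermitian hopping data:
  `Tr e^{-β(H_BdG + UΣn↑n↓)} = e^{-βΣ_x(τ(x,x)-μ)} Σ_k (-U)^k (-β)^k ∫_{0≤u₀≤…≤u_{k-1}≤1} Σ_{x⃗∈Λ^k} Z₀(𝓚) det G'_k(𝓚; x⃗, u) du`,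
  an entire series in `U` in every finite volume whose coefficients are determinants of the free
  propagator of `𝓚` (which carries the pair source as a spin-flip hopping).
* `hasSum_partitionFn_dWaveSourceTorus_det` — the same for `dWaveSourceTorus L U μ h`
  (`e^{-βΣ(τ(x,x)-μ)} = e^{βμL²}`): the starting formula for a determinant (not Pfaffian)
  perturbative / multiscale analysis of the sourced pressure of the weakly interacting 2D Hubbard
  model with a `d`-wave pair source (Koma–Tasaki order-parameter source, `DWaveSource.lean`).

Everything is PROVED; the only definition is the one-body matrix `shibaOneBody`.

## References

* H. Shiba, Prog. Theor. Phys. 48 (1972) 2171, §2; E. H. Lieb, PRL 62 (1989) 1201, proof of Thm 2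
  (the partial particle–hole transformation, `U ↦ -U`). [Shiba1972] [Lieb1989]
* G. Benfatto, A. Giuliani, V. Mastropietro, Ann. Henri Poincaré 7 (2006) 809, §2.1 (2.6)
  (the perturbation series of the partition function in determinant / Grassmann form).
  [BenfattoGiulianiMastropietro2006]
* T. Koma, H. Tasaki, J. Stat. Phys. 76 (1994) 745, §1 (the symmetry-breaking source). [KomaTasaki1994]
-/

noncomputable section

namespace Literature.MathematicalPhysics.QuantumLattice

open Matrix Finset HubbardWave0 NormedSpace Literature.Probability.LatticeModels
open scoped ComplexOrder ComplexConjugate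

/-! ### The one-body matrix of the transformed model -/

section General

variable {Λ : Type*} [LinearOrder Λ] [Fintype Λ]

/-- **The one-body matrix of the Shiba/Lieb-transformed "BdG + on-site interaction" model**:
`𝓚(τ,Δ,μ,U) = bdgNambuMatrix τ Δ μ + diag(U·[σ = ↑])` — the Nambu matrix of the BdG data (the
pairing as a spin-flip hopping, the spin-down block particle–hole reversed) plus the Hartree-like
shift `U` on the spin-up orbitals coming from `W (UΣn↑n↓) Wᴴ = U N_↑ - UΣn↑n↓`. Shiba 1972 §2;
Lieb 1989, proof of Thm 2; Micnas–Ranninger–Robaszkiewicz 1990 §II.B. [cite: Shiba1972, §2] -/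
def shibaOneBody (τ Δ : Λ → Λ → ℂ) (μ : ℝ) (U : ℂ) : Matrix (Orb Λ) (Orb Λ) ℂ :=
  bdgNambuMatrix τ Δ μ + diagonal fun o => if (ofLex o).2 = 0 then U else 0

/-- `𝓚` unfolded. [folklore] -/
theorem shibaOneBody_eq (τ Δ : Λ → Λ → ℂ) (μ : ℝ) (U : ℂ) :
    shibaOneBody τ Δ μ U =
      bdgNambuMatrix τ Δ μ + diagonal fun o => if (ofLex o).2 = 0 then U else 0 := rfl

/-- **`𝓚` is Hermitian** for Hermitian hopping amplitudes (`conj τ(x,y) = τ(y,x)`), any pairing, real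
`μ` and REAL coupling `U`. [folklore] -/
theorem isHermitian_shibaOneBody {τ : Λ → Λ → ℂ} (hτ : ∀ x y, star (τ x y) = τ y x)
    (Δ : Λ → Λ → ℂ) (μ U : ℝ) :
    (shibaOneBody τ Δ μ (U : ℂ)).IsHermitian := by
  refine (isHermitian_bdgNambuMatrix hτ Δ μ).add (isHermitian_diagonal_of_self_adjoint _ ?_)
  -- the diagonal entries `U·[σ = ↑]` are real
  change star (fun o : Orb Λ => if (ofLex o).2 = 0 then (U : ℂ) else 0) =
    fun o : Orb Λ => if (ofLex o).2 = 0 then (U : ℂ) else 0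
  funext o
  simp only [Pi.star_apply, apply_ite star, Complex.star_def, Complex.conj_ofReal, map_zero]

/-- The Hartree-like term is quadratic: `U Σ_x n_{x↑} = dΓ(diag(U·[σ = ↑]))`. [folklore] -/
theorem smul_sum_numberOp_up_eq_dGamma (U : ℂ) :
    U • ∑ x : Λ, numberOp x 0 = dGamma (diagonal fun o : Orb Λ => if (ofLex o).2 = 0 then U else 0) := by
  rw [dGamma_diagonal, sum_orb_eq_sum_sum, Finset.smul_sum]
  refine Finset.sum_congr rfl fun x _ => ?_
  rw [Fin.sum_univ_two]
  simp only [orb, ofLex_toLex, Fin.isValue, if_true, one_ne_zero, if_false, zero_smul, add_zero]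
  rfl

/-- **The transformed "BdG + on-site repulsion" as a quartic perturbation of a free Fermi gas**:
`W (H_BdG(τ,Δ,μ) + U Σ_x n_{x↑}n_{x↓}) Wᴴ = dΓ(𝓚) + (-U) Σ_x c†_{x↑}c_{x↑}(c†_{x↓}c_{x↓}) + (Σ_x (τ(x,x) - μ))·1`,
`𝓚 = shibaOneBody τ Δ μ U` — exactly the shape `dΓ(h) + g Σ_r W_r` of the tree's Dyson/Wick
theorems (`hasSum_dyson_partitionFn_quartic`), with the ATTRACTIVE coupling `g = -U`.
[cite: Lieb1989, proof of Theorem 2] -/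
theorem partialParticleHole_conj_bdgBondHamiltonian_add_onSite_eq_dGamma (τ Δ : Λ → Λ → ℂ) (μ : ℝ)
    (U : ℂ) :
    partialParticleHole (spinDownOrbitals : Finset (Orb Λ)) *
        (bdgBondHamiltonian τ Δ μ + U • ∑ x : Λ, numberOp x 0 * numberOp x 1) *
        (partialParticleHole (spinDownOrbitals : Finset (Orb Λ)))ᴴ =
      dGamma (shibaOneBody τ Δ μ U) +
        (-U) • (∑ x : Λ, creation (orb x 0) * annihilation (orb x 0) *
          (creation (orb x 1) * annihilation (orb x 1))) +
        (∑ x : Λ, (τ x x - μ)) • (1 : Matrix (Finset (Orb Λ)) (Finset (Orb Λ)) ℂ) := by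
  rw [partialParticleHole_conj_bdgBondHamiltonian_add_onSite, smul_sub, smul_sum_numberOp_up_eq_dGamma,
    shibaOneBody, dGamma_add, neg_smul, ← sub_eq_add_neg]
  simp only [numberOp]
  abel

/-- **Partition function of "BdG + on-site repulsion" as that of an attractive quartic perturbation
of the free gas `dΓ(𝓚)`**:
`Tr e^{-β(H_BdG(τ,Δ,μ) + UΣn↑n↓)} = e^{-βΣ_x(τ(x,x)-μ)} · Tr e^{-β(dΓ(𝓚) + (-U)Σ_x c†_{x↑}c_{x↑}c†_{x↓}c_{x↓})}`.
[cite: Lieb1989, proof of Theorem 2] -/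
theorem partitionFn_bdgBondHamiltonian_add_onSite_eq_shiba (τ Δ : Λ → Λ → ℂ) (μ : ℝ) (U : ℂ)
    (β : ℝ) :
    partitionFn β (bdgBondHamiltonian τ Δ μ + U • ∑ x : Λ, numberOp x 0 * numberOp x 1) =
      Complex.exp (-(β : ℂ) * ∑ x : Λ, (τ x x - μ)) *
        partitionFn β (dGamma (shibaOneBody τ Δ μ U) +
          (-U) • ∑ x : Λ, creation (orb x 0) * annihilation (orb x 0) *
            (creation (orb x 1) * annihilation (orb x 1))) := by
  have hW : partialParticleHole (spinDownOrbitals : Finset (Orb Λ)) ∈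
      unitary (Matrix (Finset (Orb Λ)) (Finset (Orb Λ)) ℂ) :=
    partialParticleHole_mem_unitaryGroup _
  rw [← partitionFn_unitary_conj hW β (bdgBondHamiltonian τ Δ μ + U • _), star_eq_conjTranspose,
    partialParticleHole_conj_bdgBondHamiltonian_add_onSite_eq_dGamma, partitionFn,
    gibbsWeight_add_smul_one, trace_smul, smul_eq_mul, partitionFn]

/-- **The Dyson series in `U` of the "BdG + on-site repulsion" partition function, determinant
form (finite volume).** For Hermitian hopping data, any pairing, real `μ, U, β`:
`Tr e^{-β(H_BdG(τ,Δ,μ) + UΣn↑n↓)} = e^{-βΣ_x(τ(x,x)-μ)} Σ_k (-U)^k (-β)^k ∫_{0≤u₀≤⋯≤u_{k-1}≤1} Σ_{x⃗∈Λ^k} Z₀(𝓚) det G'_k(x⃗,u) du`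
with `Z₀(𝓚) = Tr e^{-βdΓ(𝓚)}` and the `2k × 2k` matrix of free propagators of `𝓚 = shibaOneBody τ Δ μ U`
between the pairs of `∏_i n_{x_i↑}(s_i) n_{x_i↓}(s_i)` (`s_i = -βu_i`; position `2i + j` ↔ orbital
`(x_i, j)`; entry `[e^{-s_b𝓚}(1+e^{β𝓚})⁻¹e^{s_a𝓚}]_{o_b o_a}` on and above the diagonal,
`-[e^{-s_b𝓚}(1+e^{-β𝓚})⁻¹e^{s_a𝓚}]_{o_b o_a}` below) — BGM's (2.6) for the Shiba-transformed model:
the Dyson expansion (`hasSum_dyson_partitionFn_quartic`) and the time-ordered Wick theorem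
(`gibbsState_dGamma_prod_hubbardVertex_eq_det`) applied to `dΓ(𝓚) + (-U)·(quartic word)`.
[cite: BenfattoGiulianiMastropietro2006, §2.1 (2.6)] -/
theorem hasSum_partitionFn_bdgBondHamiltonian_add_onSite_det {τ : Λ → Λ → ℂ}
    (hτ : ∀ x y, star (τ x y) = τ y x) (Δ : Λ → Λ → ℂ) (μ U β : ℝ) :
    HasSum (fun k : ℕ => Complex.exp (-(β : ℂ) * ∑ x : Λ, (τ x x - μ)) *
      ((-(U : ℂ)) ^ k * orderedIntegral k (fun u : Fin k → ℝ =>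
        (-(β : ℂ)) ^ k * ∑ f : Fin k → Λ, Matrix.partitionFn β (dGamma (shibaOneBody τ Δ μ (U : ℂ))) *
          (Matrix.of fun a b : Fin (k * 2) =>
            if a ≤ b then
              (exp (-((((u (finProdFinEquiv.symm b).1 : ℝ) : ℂ) * -(β : ℂ)) • shibaOneBody τ Δ μ (U : ℂ))) *
                  (1 + exp ((β : ℂ) • shibaOneBody τ Δ μ (U : ℂ)))⁻¹ *
                exp ((((u (finProdFinEquiv.symm a).1 : ℝ) : ℂ) * -(β : ℂ)) • shibaOneBody τ Δ μ (U : ℂ)))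
                (orb (f (finProdFinEquiv.symm b).1) (finProdFinEquiv.symm b).2)
                (orb (f (finProdFinEquiv.symm a).1) (finProdFinEquiv.symm a).2)
            else
              -(exp (-((((u (finProdFinEquiv.symm b).1 : ℝ) : ℂ) * -(β : ℂ)) • shibaOneBody τ Δ μ (U : ℂ))) *
                  (1 + exp (-((β : ℂ) • shibaOneBody τ Δ μ (U : ℂ))))⁻¹ *
                exp ((((u (finProdFinEquiv.symm a).1 : ℝ) : ℂ) * -(β : ℂ)) • shibaOneBody τ Δ μ (U : ℂ)))
                (orb (f (finProdFinEquiv.symm b).1) (finProdFinEquiv.symm b).2)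
                (orb (f (finProdFinEquiv.symm a).1) (finProdFinEquiv.symm a).2)).det) 1))
      (Matrix.partitionFn β (bdgBondHamiltonian τ Δ μ + (U : ℂ) • ∑ x : Λ, numberOp x 0 * numberOp x 1)) := by
  haveI : Nonempty (Finset (Orb Λ)) := ⟨∅⟩
  have hK : (shibaOneBody τ Δ μ (U : ℂ)).IsHermitian := isHermitian_shibaOneBody hτ Δ μ U
  have hZ : Matrix.partitionFn β (dGamma (shibaOneBody τ Δ μ (U : ℂ))) ≠ 0 :=
    (Matrix.partitionFn_pos β (isHermitian_dGamma hK)).ne'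
  -- the Dyson series of the transformed model, in trace form
  have hs := hasSum_dyson_partitionFn_quartic β (shibaOneBody τ Δ μ (U : ℂ)) (fun _ : Λ => (1 : ℂ))
    (fun z => orb z 0) (fun z => orb z 0) (fun z => orb z 1) (fun z => orb z 1) (-(U : ℂ))
  simp only [Finset.prod_const_one, one_mul, one_smul] at hs
  rw [partitionFn_bdgBondHamiltonian_add_onSite_eq_shiba]
  refine (hs.mul_left _).congr_fun fun k => ?_
  refine congrArg (fun F => Complex.exp (-(β : ℂ) * ∑ x : Λ, (τ x x - μ)) *
    ((-(U : ℂ)) ^ k * orderedIntegral k F 1)) (funext fun u => ?_)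
  refine congrArg (fun S => (-(β : ℂ)) ^ k * S) (Finset.sum_congr rfl fun f _ => ?_)
  rw [← gibbsState_dGamma_prod_hubbardVertex_eq_det hK β f (fun i : Fin k => ((u i : ℝ) : ℂ) * -(β : ℂ)),
    Matrix.gibbsState_apply, mul_inv_cancel_left₀ hZ]

end General

/-! ### The `d`-wave–sourced Hubbard torus -/

section Torus

variable (L : ℕ) [NeZero L]

/-- **The Dyson series in `U` of the `d`-wave–sourced Hubbard partition function, determinant
form (finite torus).** For every `L ≥ 1` and all real `β, U, μ, h`:
`Tr e^{-β dWaveSourceTorus L U μ h} = e^{βμL²} Σ_k (-U)^k (-β)^k ∫_{0≤u₀≤⋯≤u_{k-1}≤1} Σ_{x⃗} Z₀(𝓚) det G'_k(𝓚; x⃗, u) du`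
with `𝓚 = shibaOneBody τ_L Δ_{L,h} μ U` the one-body matrix of the Shiba-transformed sourced torus
(`τ_L = -[x∼y]`, `Δ_{L,h}` the `d`-wave bond pairing of strength `-h√2(±1)`,
`dWaveSourceTorus_eq_bdgBondHamiltonian_add`): the pair source sits in the FREE propagator, the
interaction is the attractive on-site quartic word, and the series is entire in `U` in every finite
volume — the starting point of a determinant expansion of the sourced pressure.
[cite: BenfattoGiulianiMastropietro2006, §2.1 (2.6)] -/
theorem hasSum_partitionFn_dWaveSourceTorus_det (β U μ h : ℝ) :
    HasSum (fun k : ℕ => (Real.exp (β * (μ * (L : ℝ) ^ 2)) : ℂ) *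
      ((-(U : ℂ)) ^ k * orderedIntegral k (fun u : Fin k → ℝ =>
        (-(β : ℂ)) ^ k * ∑ f : Fin k → FermionTorus 2 L,
          Matrix.partitionFn β (dGamma (shibaOneBody
            (fun x y => if (fermionTorusGraph 2 L).Adj x y then -(1 : ℂ) else 0)
            (fun u v : FermionTorus 2 L => -(h : ℂ) * ∑ i : Fin 2,
              if v = FermionTorus.ofTorusSite (u.toTorusSite + Pi.single i 1) then
                ((Real.sqrt 2 * (if i = 0 then 1 else -1) : ℝ) : ℂ) else 0) μ (U : ℂ))) *
          (Matrix.of fun a b : Fin (k * 2) =>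
            if a ≤ b then
              (exp (-((((u (finProdFinEquiv.symm b).1 : ℝ) : ℂ) * -(β : ℂ)) • shibaOneBody
                    (fun x y => if (fermionTorusGraph 2 L).Adj x y then -(1 : ℂ) else 0)
                    (fun u v : FermionTorus 2 L => -(h : ℂ) * ∑ i : Fin 2,
                      if v = FermionTorus.ofTorusSite (u.toTorusSite + Pi.single i 1) then
                        ((Real.sqrt 2 * (if i = 0 then 1 else -1) : ℝ) : ℂ) else 0) μ (U : ℂ))) *
                  (1 + exp ((β : ℂ) • shibaOneBody
                    (fun x y => if (fermionTorusGraph 2 L).Adj x y then -(1 : ℂ) else 0)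
                    (fun u v : FermionTorus 2 L => -(h : ℂ) * ∑ i : Fin 2,
                      if v = FermionTorus.ofTorusSite (u.toTorusSite + Pi.single i 1) then
                        ((Real.sqrt 2 * (if i = 0 then 1 else -1) : ℝ) : ℂ) else 0) μ (U : ℂ)))⁻¹ *
                exp ((((u (finProdFinEquiv.symm a).1 : ℝ) : ℂ) * -(β : ℂ)) • shibaOneBody
                    (fun x y => if (fermionTorusGraph 2 L).Adj x y then -(1 : ℂ) else 0)
                    (fun u v : FermionTorus 2 L => -(h : ℂ) * ∑ i : Fin 2,
                      if v = FermionTorus.ofTorusSite (u.toTorusSite + Pi.single i 1) then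
                        ((Real.sqrt 2 * (if i = 0 then 1 else -1) : ℝ) : ℂ) else 0) μ (U : ℂ)))
                (orb (f (finProdFinEquiv.symm b).1) (finProdFinEquiv.symm b).2)
                (orb (f (finProdFinEquiv.symm a).1) (finProdFinEquiv.symm a).2)
            else
              -(exp (-((((u (finProdFinEquiv.symm b).1 : ℝ) : ℂ) * -(β : ℂ)) • shibaOneBody
                    (fun x y => if (fermionTorusGraph 2 L).Adj x y then -(1 : ℂ) else 0)
                    (fun u v : FermionTorus 2 L => -(h : ℂ) * ∑ i : Fin 2,
                      if v = FermionTorus.ofTorusSite (u.toTorusSite + Pi.single i 1) then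
                        ((Real.sqrt 2 * (if i = 0 then 1 else -1) : ℝ) : ℂ) else 0) μ (U : ℂ))) *
                  (1 + exp (-((β : ℂ) • shibaOneBody
                    (fun x y => if (fermionTorusGraph 2 L).Adj x y then -(1 : ℂ) else 0)
                    (fun u v : FermionTorus 2 L => -(h : ℂ) * ∑ i : Fin 2,
                      if v = FermionTorus.ofTorusSite (u.toTorusSite + Pi.single i 1) then
                        ((Real.sqrt 2 * (if i = 0 then 1 else -1) : ℝ) : ℂ) else 0) μ (U : ℂ))))⁻¹ *
                exp ((((u (finProdFinEquiv.symm a).1 : ℝ) : ℂ) * -(β : ℂ)) • shibaOneBody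
                    (fun x y => if (fermionTorusGraph 2 L).Adj x y then -(1 : ℂ) else 0)
                    (fun u v : FermionTorus 2 L => -(h : ℂ) * ∑ i : Fin 2,
                      if v = FermionTorus.ofTorusSite (u.toTorusSite + Pi.single i 1) then
                        ((Real.sqrt 2 * (if i = 0 then 1 else -1) : ℝ) : ℂ) else 0) μ (U : ℂ)))
                (orb (f (finProdFinEquiv.symm b).1) (finProdFinEquiv.symm b).2)
                (orb (f (finProdFinEquiv.symm a).1) (finProdFinEquiv.symm a).2)).det) 1))
      (Matrix.partitionFn β (dWaveSourceTorus L U μ h)) := by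
  have hcard : (Fintype.card (FermionTorus 2 L) : ℂ) = (L : ℂ) ^ 2 := by
    simp [FermionTorus, Fintype.card_lex]
  have hdiag : (∑ x : FermionTorus 2 L,
      ((if (fermionTorusGraph 2 L).Adj x x then -(1 : ℂ) else 0) - μ)) = -((μ : ℂ) * (L : ℂ) ^ 2) := by
    simp only [SimpleGraph.irrefl, if_false, zero_sub, Finset.sum_neg_distrib, Finset.sum_const,
      Finset.card_univ, nsmul_eq_mul, hcard]
    ring
  have hτ : ∀ x y : FermionTorus 2 L,
      star (if (fermionTorusGraph 2 L).Adj x y then -(1 : ℂ) else 0) =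
        (if (fermionTorusGraph 2 L).Adj y x then -(1 : ℂ) else 0) := by
    intro x y
    rw [apply_ite star, star_neg, star_one, star_zero]
    simp only [(fermionTorusGraph 2 L).adj_comm x y]
  have key := hasSum_partitionFn_bdgBondHamiltonian_add_onSite_det (Λ := FermionTorus 2 L) hτ
    (fun u v : FermionTorus 2 L => -(h : ℂ) * ∑ i : Fin 2,
      if v = FermionTorus.ofTorusSite (u.toTorusSite + Pi.single i 1) then
        ((Real.sqrt 2 * (if i = 0 then 1 else -1) : ℝ) : ℂ) else 0) μ U β
  rw [hdiag, show -(β : ℂ) * -((μ : ℂ) * (L : ℂ) ^ 2) = ((β * (μ * (L : ℝ) ^ 2) : ℝ) : ℂ) by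
      push_cast; ring, ← Complex.ofReal_exp, ← dWaveSourceTorus_eq_bdgBondHamiltonian_add] at key
  -- the generic (`LinearOrder Λ`) and the concrete (`Lex`) `DecidableEq` paths meet here
  convert key

end Torus

end Literature.MathematicalPhysics.QuantumLattice

end
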